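import Summits.Parity.BatemanHorn.Theorems.SoloInformedRootCountGamma
import Literature.NumberTheory.Sieve.GoldstonGrahamPintzYildirimLemma3
import Literature.NumberTheory.LFunctions.PolynomialRootMertensFirst
import HarnessLib

/-!
# The squarefree level of the root count of an irreducible polynomial:
# `∑_{d ≤ x, μ²(d) = 1, (d, m) = 1} ρ_g(d)/d = c_{g,m} log x + O_g(1 + log m)`

Solo informed line (Parity / Bateman–Horn), session 136.  This is the first half of the
Dedekind–Landau mean value `∑_{d ≤ x} ρ_g(d)/d = A_g log x + O(1)` for an irreducible `g ∈ ℤ[X]`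
of positive degree (the hypothesis `hL` of
`SoloInformedDivisorPairingStorey.exists_abs_polyDivisorSum_sub_located_sub_log_le`), obtained
WITHOUT any analytic input beyond what the tree already proves:

* the Goldston–Graham–Pintz–Yıldırım / Halberstam–Richert mean-value lemma in dimension `1`,
  `GGPY.moebiusSqGSum_asymptotic_holds` (PROVED in the tree), applied to the weight `γ_{g,m}` of
  `SoloInformedRootCountGamma.lean` (where `(Ω₁)` and the identification of the lemma's sum with
  `polySqfreeLevel g m x` are proved);
* hypothesis `(Ω₂(1, L))` with `L = L₀ + deg g · log m` and `A₂` independent of `m`, from Landau's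
  Mertens theorem for the roots of `g`,
  `Literature.NumberTheory.LFunctions.DegreeOnePrimes.abs_sum_primesLE_rootCount_mul_log_div_sub_log_le`
  (PROVED in the tree), the pointwise comparison
  `0 ≤ ρ log p/p − γ log p/p ≤ deg g · log p · 1_{p ∣ m} + (deg g)² · 2 p^{−3/2}`,
  `∑_{p ∣ m} log p ≤ log m` and `∑ p^{−3/2} < ∞` (`hypOmega2_rootGamma`).

Main statement: `exists_abs_polySqfreeLevel_sub_le` — there is `K = K(g)` with
`|polySqfreeLevel g m x − c_{g,m} log x| ≤ K (1 + log m)` for all `m ≥ 1`, `x ≥ 1`, where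
`c_{g,m} = rootDensityConst g m` is GGPY's constant `c_γ` (its partial products converge to it),
`0 ≤ c_{g,m} ≤ c_{g,1}`; and the case `m = 1` (`exists_abs_polySqfreeLevel_one_sub_le`).  The
complementary squarefull convolution is the business of a separate file.
-/

noncomputable section

open Finset Real Polynomial Filter Topology

namespace Summit.Parity.BatemanHorn.Theorems

open Literature.NumberTheory.Sieve

/-! ### Hypothesis `(Ω₂(1, L))` from Mertens' theorem for the roots of `g` -/

/-- `∑ k^{−3/2}` converges. [folklore] -/
theorem summable_rpow_three_halves_inv :
    Summable (fun k : ℕ => ((k : ℝ) ^ (3 / 2 : ℝ))⁻¹) :=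
  Real.summable_nat_rpow_inv.2 (by norm_num)

/-- `log p / p² ≤ 2 p^{−3/2}`. [folklore] -/
theorem log_div_sq_le {p : ℕ} (hp : 0 < p) :
    Real.log p / (p : ℝ) ^ 2 ≤ 2 * ((p : ℝ) ^ (3 / 2 : ℝ))⁻¹ := by
  have hp0 : (0 : ℝ) < p := by exact_mod_cast hp
  have h1 : Real.log p ≤ (p : ℝ) ^ (1 / 2 : ℝ) / (1 / 2) :=
    Real.log_le_rpow_div hp0.le (by norm_num)
  have h3 : (p : ℝ) ^ 2 = (p : ℝ) ^ (1 / 2 : ℝ) * (p : ℝ) ^ (3 / 2 : ℝ) := by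
    rw [← Real.rpow_add hp0, show (1 / 2 : ℝ) + 3 / 2 = 2 by norm_num, Real.rpow_two]
  have h32 : (0 : ℝ) < (p : ℝ) ^ (3 / 2 : ℝ) := by positivity
  rw [div_le_iff₀ (by positivity), h3]
  have h4 : 2 * ((p : ℝ) ^ (3 / 2 : ℝ))⁻¹ * ((p : ℝ) ^ (1 / 2 : ℝ) * (p : ℝ) ^ (3 / 2 : ℝ)) =
      2 * (p : ℝ) ^ (1 / 2 : ℝ) := by
    field_simp
  rw [h4]
  linarith

/-- A prime window sum is a difference of two sums over `primesLE`. [folklore] -/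
theorem sum_filter_prime_Ico_eq_sub (f : ℕ → ℝ) {a b : ℕ} (ha : 1 ≤ a) (hab : a ≤ b) :
    ∑ p ∈ (Ico a b).filter Nat.Prime, f p =
      ∑ p ∈ Nat.primesLE (b - 1), f p - ∑ p ∈ Nat.primesLE (a - 1), f p := by
  rw [Finset.sum_filter, Finset.sum_Ico_eq_sub _ hab]
  have h : ∀ t : ℕ, 1 ≤ t →
      ∑ p ∈ Nat.primesLE (t - 1), f p = ∑ p ∈ range t, if p.Prime then f p else 0 := by
    intro t ht
    rw [Nat.primesLE_eq_filter_range, Finset.sum_filter, Nat.sub_add_cancel ht]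
  rw [h b (ha.trans hab), h a ha]

/-- `|log(⌈t⌉ − 1) − log t| ≤ log 2` for `t ≥ 2`. [folklore] -/
theorem abs_log_ceil_sub_one_sub_log_le {t : ℝ} (ht : 2 ≤ t) :
    |Real.log ((⌈t⌉₊ - 1 : ℕ) : ℝ) - Real.log t| ≤ Real.log 2 := by
  have ht0 : 0 ≤ t := by linarith
  have h1 : ((⌈t⌉₊ : ℕ) : ℝ) < t + 1 := Nat.ceil_lt_add_one ht0
  have h2 : t ≤ ((⌈t⌉₊ : ℕ) : ℝ) := Nat.le_ceil t
  have hc1 : 1 ≤ ⌈t⌉₊ := by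
    have : (1 : ℝ) ≤ ((⌈t⌉₊ : ℕ) : ℝ) := by linarith
    exact_mod_cast this
  have hq : (((⌈t⌉₊ - 1 : ℕ)) : ℝ) = ((⌈t⌉₊ : ℕ) : ℝ) - 1 := by
    rw [Nat.cast_sub hc1, Nat.cast_one]
  rw [hq]
  have hq1 : t - 1 ≤ ((⌈t⌉₊ : ℕ) : ℝ) - 1 := by linarith
  have hq2 : ((⌈t⌉₊ : ℕ) : ℝ) - 1 < t := by linarith
  have hqpos : 0 < ((⌈t⌉₊ : ℕ) : ℝ) - 1 := by linarith
  have hlog : Real.log (((⌈t⌉₊ : ℕ) : ℝ) - 1) ≤ Real.log t := Real.log_le_log hqpos hq2.le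
  rw [abs_sub_comm, abs_of_nonneg (by linarith), ← Real.log_div (by linarith) hqpos.ne']
  apply Real.log_le_log (by positivity)
  rw [div_le_iff₀ hqpos]
  linarith

/-- Pointwise comparison of the `(Ω₂)` summands of `γ_{g,m}` and of `ρ_g`. [this work] -/
theorem rootGamma_term_bounds {g : ℤ[X]} (hirr : Irreducible g) (hdeg : 0 < g.natDegree)
    (m : ℕ) {p : ℕ} (hp : p.Prime) :
    0 ≤ (polyRootCountMod ![g] p : ℝ) * Real.log p / p - rootGamma g m p * Real.log p / p ∧
    (polyRootCountMod ![g] p : ℝ) * Real.log p / p - rootGamma g m p * Real.log p / p ≤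
      (g.natDegree : ℝ) * (if p ∣ m then Real.log p else 0) +
        (g.natDegree : ℝ) ^ 2 * (2 * ((p : ℝ) ^ (3 / 2 : ℝ))⁻¹) := by
  set n : ℝ := (g.natDegree : ℝ) with hn
  set ρ : ℝ := (polyRootCountMod ![g] p : ℝ) with hρ
  have hp0 : (0 : ℝ) < p := by exact_mod_cast hp.pos
  have hp1 : (1 : ℝ) ≤ p := by exact_mod_cast hp.one_lt.le
  have hlog : 0 ≤ Real.log p := Real.log_natCast_nonneg p
  have hρ0 : 0 ≤ ρ := Nat.cast_nonneg _
  have hρn : ρ ≤ n := by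
    rw [hρ, hn]
    exact_mod_cast polyRootCountMod_prime_le_natDegree_of_irreducible hirr hdeg hp
  have hn0 : 0 ≤ n := Nat.cast_nonneg _
  have hT0 : 0 ≤ 2 * ((p : ℝ) ^ (3 / 2 : ℝ))⁻¹ := by positivity
  by_cases h : p ∣ m
  · rw [rootGamma_of_dvd g m h, if_pos h]
    simp only [zero_mul, zero_div, sub_zero]
    refine ⟨by positivity, ?_⟩
    have h1 : ρ * Real.log p / p ≤ n * Real.log p := by
      rw [div_le_iff₀ hp0]
      nlinarith [mul_nonneg hn0 hlog, mul_nonneg hρ0 hlog]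
    nlinarith [mul_nonneg (pow_nonneg hn0 2) hT0]
  · rw [if_neg h, mul_zero, zero_add]
    have hpr : (0 : ℝ) < p + ρ := by positivity
    have hγ : rootGamma g m p * Real.log p / p = ρ * Real.log p / (p + ρ) := by
      rw [rootGamma_of_not_dvd g m h, ← hρ]
      field_simp
    rw [hγ]
    have hdiff : ρ * Real.log p / p - ρ * Real.log p / (p + ρ) =
        ρ ^ 2 * Real.log p / (p * (p + ρ)) := by
      field_simp
      ring
    rw [hdiff]
    refine ⟨by positivity, ?_⟩
    calc ρ ^ 2 * Real.log p / (p * (p + ρ))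
        ≤ n ^ 2 * (Real.log p / (p : ℝ) ^ 2) := by
          rw [div_le_iff₀ (by positivity)]
          have h1 : ρ ^ 2 ≤ n ^ 2 := pow_le_pow_left₀ hρ0 hρn 2
          have h2 : (p : ℝ) ^ 2 ≤ p * (p + ρ) := by nlinarith
          calc ρ ^ 2 * Real.log p ≤ n ^ 2 * Real.log p := mul_le_mul_of_nonneg_right h1 hlog
            _ = n ^ 2 * (Real.log p / (p : ℝ) ^ 2) * (p : ℝ) ^ 2 := by
                field_simp
            _ ≤ n ^ 2 * (Real.log p / (p : ℝ) ^ 2) * (p * (p + ρ)) :=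
                mul_le_mul_of_nonneg_left h2 (by positivity)
      _ ≤ n ^ 2 * (2 * ((p : ℝ) ^ (3 / 2 : ℝ))⁻¹) :=
          mul_le_mul_of_nonneg_left (log_div_sq_le hp.pos) (by positivity)

/-- `∑_{p ∣ m} log p ≤ log m` over any finite set of primes dividing `m ≥ 1`. [folklore] -/
theorem sum_ite_dvd_log_le {m : ℕ} (hm : 0 < m) (W : Finset ℕ) (hW : ∀ p ∈ W, p.Prime) :
    ∑ p ∈ W, (if p ∣ m then Real.log p else 0) ≤ Real.log m := by
  rw [← Finset.sum_filter]
  calc ∑ p ∈ W.filter (fun p => p ∣ m), Real.log p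
      ≤ ∑ p ∈ m.primeFactors, Real.log p := by
        apply Finset.sum_le_sum_of_subset_of_nonneg
        · intro p hp
          rw [Finset.mem_filter] at hp
          exact Nat.mem_primeFactors.2 ⟨hW p hp.1, hp.2, hm.ne'⟩
        · intro p _ _
          exact Real.log_natCast_nonneg p
    _ = Real.log (∏ p ∈ m.primeFactors, (p : ℝ)) := by
        rw [Real.log_prod]
        intro p hp
        exact_mod_cast (Nat.prime_of_mem_primeFactors hp).ne_zero
    _ ≤ Real.log m := by
        have hpos : (0 : ℝ) < ∏ p ∈ m.primeFactors, (p : ℝ) :=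
          Finset.prod_pos fun p hp => by exact_mod_cast (Nat.prime_of_mem_primeFactors hp).pos
        apply Real.log_le_log hpos
        rw [← Nat.cast_prod]
        exact_mod_cast Nat.le_of_dvd hm (Nat.prod_primeFactors_dvd m)

/-- `(Ω₂(1, L))` for `γ_{g,m}`, with `A₂` independent of `m` and `L = L₀ + deg g · log m`.
[this work] -/
theorem hypOmega2_rootGamma {g : ℤ[X]} (hirr : Irreducible g) (hdeg : 0 < g.natDegree) :
    ∃ A₂ L₀ : ℝ, 0 < A₂ ∧ 1 ≤ L₀ ∧ ∀ m : ℕ, 0 < m →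
      GGPY.HypOmega2 (rootGamma g m) 1 A₂ (L₀ + (g.natDegree : ℝ) * Real.log m) := by
  obtain ⟨C, hC⟩ :=
    Literature.NumberTheory.LFunctions.DegreeOnePrimes.abs_sum_primesLE_rootCount_mul_log_div_sub_log_le
      g hirr hdeg
  set n : ℝ := (g.natDegree : ℝ) with hn
  set T : ℝ := ∑' k : ℕ, ((k : ℝ) ^ (3 / 2 : ℝ))⁻¹ with hT
  set C' : ℝ := max C 0 with hC'
  set ρ : ℕ → ℝ := fun p => (polyRootCountMod ![g] p : ℝ) with hρ
  set M : ℕ → ℝ := fun Q => ∑ p ∈ Nat.primesLE Q, ρ p * Real.log p / p with hM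
  have hC'0 : 0 ≤ C' := le_max_right _ _
  have hT0 : 0 ≤ T := tsum_nonneg fun k => by positivity
  have hn0 : 0 ≤ n := Nat.cast_nonneg _
  have hlog2 : 0 < Real.log 2 := Real.log_pos (by norm_num)
  have hMer : ∀ Q : ℕ, 1 ≤ Q → |M Q - Real.log Q| ≤ C' := by
    intro Q hQ
    rcases eq_or_lt_of_le hQ with h | hQ2
    · rw [← h]
      simp [hM, Nat.primesLE_one, hC'0]
    · exact (hC Q hQ2).trans (le_max_left _ _)
  refine ⟨2 * C' + 2 * Real.log 2 + 1, 2 * C' + 2 * Real.log 2 + 2 * n ^ 2 * T + 1,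
    by positivity, by nlinarith [sq_nonneg n], fun m hm => ?_⟩
  intro w z hw hwz
  have hz : 2 ≤ z := hw.trans hwz
  set a : ℕ := ⌈w⌉₊ with ha
  set b : ℕ := ⌈z⌉₊ with hb
  have ha2 : 2 ≤ a := by
    have : (2 : ℝ) ≤ ((a : ℕ) : ℝ) := hw.trans (Nat.le_ceil w)
    exact_mod_cast this
  have hab : a ≤ b := Nat.ceil_le_ceil hwz
  set W : Finset ℕ := (Ico a b).filter Nat.Prime with hWdef
  have hWp : ∀ p ∈ W, p.Prime := fun p hp => (Finset.mem_filter.1 hp).2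
  set Δ : ℝ := ∑ p ∈ W, (ρ p * Real.log p / p - rootGamma g m p * Real.log p / p) with hΔ
  have hsplit : GGPY.omega2Sum (rootGamma g m) w z = (∑ p ∈ W, ρ p * Real.log p / p) - Δ := by
    unfold GGPY.omega2Sum
    rw [hΔ, ← Finset.sum_sub_distrib]
    refine Finset.sum_congr rfl fun p _ => by ring
  have hSρ : ∑ p ∈ W, ρ p * Real.log p / p = M (b - 1) - M (a - 1) :=
    sum_filter_prime_Ico_eq_sub _ (by omega) hab
  have hMb := hMer (b - 1) (by omega)
  have hMa := hMer (a - 1) (by omega)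
  have hlb := abs_log_ceil_sub_one_sub_log_le hz
  have hla := abs_log_ceil_sub_one_sub_log_le hw
  rw [← hb] at hlb
  rw [← ha] at hla
  have hΔ0 : 0 ≤ Δ :=
    Finset.sum_nonneg fun p hp => (rootGamma_term_bounds hirr hdeg m (hWp p hp)).1
  have hΔ1 : Δ ≤ n * Real.log m + n ^ 2 * (2 * T) := by
    calc Δ ≤ ∑ p ∈ W, (n * (if p ∣ m then Real.log p else 0) +
          n ^ 2 * (2 * ((p : ℝ) ^ (3 / 2 : ℝ))⁻¹)) :=
          Finset.sum_le_sum fun p hp => (rootGamma_term_bounds hirr hdeg m (hWp p hp)).2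
      _ = n * ∑ p ∈ W, (if p ∣ m then Real.log p else 0) +
          n ^ 2 * (2 * ∑ p ∈ W, ((p : ℝ) ^ (3 / 2 : ℝ))⁻¹) := by
          rw [Finset.sum_add_distrib, Finset.mul_sum, Finset.mul_sum, Finset.mul_sum]
      _ ≤ n * Real.log m + n ^ 2 * (2 * T) := by
          have h1 := sum_ite_dvd_log_le hm W hWp
          have h2 : ∑ p ∈ W, ((p : ℝ) ^ (3 / 2 : ℝ))⁻¹ ≤ T :=
            summable_rpow_three_halves_inv.sum_le_tsum W (fun k _ => by positivity)
          nlinarith [mul_le_mul_of_nonneg_left h1 hn0,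
            mul_le_mul_of_nonneg_left h2 (by positivity : (0 : ℝ) ≤ n ^ 2 * 2)]
  have hw0 : 0 < w := by linarith
  have hz0 : 0 < z := by linarith
  rw [Real.log_div hz0.ne' hw0.ne', hsplit, hSρ]
  rw [abs_le] at hMb hMa hlb hla
  constructor
  · nlinarith [hMb.1, hMa.2, hlb.1, hla.2]
  · nlinarith [hMb.2, hMa.1, hlb.2, hla.1]

/-! ### The squarefree level: `polySqfreeLevel g m x = c_{g,m} log x + O(1 + log m)` -/

/-- The partial products of `c_{g,m}` are `≥ 0`. [this work] -/
theorem cGammaPartial_rootGamma_nonneg {g : ℤ[X]} (hirr : Irreducible g)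
    (hdeg : 0 < g.natDegree) (m y : ℕ) : 0 ≤ GGPY.cGammaPartial (rootGamma g m) y := by
  unfold GGPY.cGammaPartial
  refine Finset.prod_nonneg fun p hp => ?_
  have hpp := (Nat.mem_primesBelow.1 hp).2
  have h1 := (hypOmega1_rootGamma hirr hdeg m p hpp).2
  have hA : 0 < 1 / (((g.natDegree : ℝ) + 2) / 2) := by positivity
  have hp1 : (1 : ℝ) ≤ p := by exact_mod_cast hpp.one_lt.le
  have h2 : 0 ≤ 1 - 1 / (p : ℝ) := by
    rw [sub_nonneg, div_le_one (by linarith)]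
    exact hp1
  exact mul_nonneg (inv_nonneg.2 (by linarith)) h2

/-- The partial products of `c_{g,m}` are at most those of `c_{g,1}`. [this work] -/
theorem cGammaPartial_rootGamma_le {g : ℤ[X]} (hirr : Irreducible g)
    (hdeg : 0 < g.natDegree) (m y : ℕ) :
    GGPY.cGammaPartial (rootGamma g m) y ≤ GGPY.cGammaPartial (rootGamma g 1) y := by
  unfold GGPY.cGammaPartial
  refine Finset.prod_le_prod (fun p hp => ?_) fun p hp => ?_
  · have hpp := (Nat.mem_primesBelow.1 hp).2
    have h1 := (hypOmega1_rootGamma hirr hdeg m p hpp).2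
    have hA : 0 < 1 / (((g.natDegree : ℝ) + 2) / 2) := by positivity
    have hp1 : (1 : ℝ) ≤ p := by exact_mod_cast hpp.one_lt.le
    have h2 : 0 ≤ 1 - 1 / (p : ℝ) := by
      rw [sub_nonneg, div_le_one (by linarith)]
      exact hp1
    exact mul_nonneg (inv_nonneg.2 (by linarith)) h2
  · have hpp := (Nat.mem_primesBelow.1 hp).2
    have hp0 : (0 : ℝ) < p := by exact_mod_cast hpp.pos
    have h1 := (hypOmega1_rootGamma hirr hdeg 1 p hpp).2
    have hA : 0 < 1 / (((g.natDegree : ℝ) + 2) / 2) := by positivity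
    have hp1 : (1 : ℝ) ≤ p := by exact_mod_cast hpp.one_lt.le
    have h2 : 0 ≤ 1 - 1 / (p : ℝ) := by
      rw [sub_nonneg, div_le_one (by linarith)]
      exact hp1
    have hle : rootGamma g m p / p ≤ rootGamma g 1 p / p :=
      div_le_div_of_nonneg_right (rootGamma_le_rootGamma_one g m p) hp0.le
    refine mul_le_mul_of_nonneg_right ?_ h2
    exact inv_anti₀ (by linarith) (by linarith)

/-- **The squarefree level of `ρ_g`, coprime to `m`.**  For `g ∈ ℤ[X]` irreducible of positive
degree there is `K` such that for every `m ≥ 1`: the partial products of `c_{g,m}` converge to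
`c_{g,m} = rootDensityConst g m`, `0 ≤ c_{g,m} ≤ c_{g,1}`, and for every `x ≥ 1`
`|∑_{d ≤ x, μ²(d)=1, (d,m)=1} ρ_g(d)/d − c_{g,m} log x| ≤ K (1 + log m)`.
(GGPY Lemma 3 / Halberstam–Richert 5.3–5.4 with `κ = 1` for the weight `γ_{g,m}`; `(Ω₂)` from
Landau's Mertens theorem for the roots of `g`.) [this work] -/
theorem exists_abs_polySqfreeLevel_sub_le {g : ℤ[X]} (hirr : Irreducible g)
    (hdeg : 0 < g.natDegree) :
    ∃ K : ℝ, ∀ m : ℕ, 0 < m →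
      Tendsto (GGPY.cGammaPartial (rootGamma g m)) atTop (𝓝 (rootDensityConst g m)) ∧
      0 ≤ rootDensityConst g m ∧ rootDensityConst g m ≤ rootDensityConst g 1 ∧
      ∀ x : ℕ, 1 ≤ x →
        |polySqfreeLevel g m x - rootDensityConst g m * Real.log x| ≤ K * (1 + Real.log m) := by
  obtain ⟨A₂, L₀, hA₂, hL₀, hΩ₂⟩ := hypOmega2_rootGamma hirr hdeg
  set A₁ : ℝ := ((g.natDegree : ℝ) + 2) / 2 with hA₁def
  have hA₁ : 0 < A₁ := by positivity
  obtain ⟨C₀, hC₀⟩ := GGPY.moebiusSqGSum_asymptotic_holds A₁ A₂ hA₁ hA₂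
  set n : ℝ := (g.natDegree : ℝ) with hn
  have hn0 : 0 ≤ n := Nat.cast_nonneg _
  have hmain : ∀ m : ℕ, 0 < m →
      Tendsto (GGPY.cGammaPartial (rootGamma g m)) atTop (𝓝 (rootDensityConst g m)) ∧
      ∀ z : ℝ, 2 ≤ z →
        |GGPY.moebiusSqGSum (rootGamma g m) z - rootDensityConst g m * Real.log z| ≤
          C₀ * rootDensityConst g m * (L₀ + n * Real.log m) := by
    intro m hm
    have hL : 1 ≤ L₀ + n * Real.log m := by
      have : 0 ≤ n * Real.log m := mul_nonneg hn0 (Real.log_natCast_nonneg m)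
      linarith
    exact hC₀ _ hL _ (hypOmega1_rootGamma hirr hdeg m) (hΩ₂ m hm)
  have hc0 : ∀ m : ℕ, 0 < m → 0 ≤ rootDensityConst g m := fun m hm =>
    ge_of_tendsto' (hmain m hm).1 fun y => cGammaPartial_rootGamma_nonneg hirr hdeg m y
  have hc1 : ∀ m : ℕ, 0 < m → rootDensityConst g m ≤ rootDensityConst g 1 := fun m hm =>
    le_of_tendsto_of_tendsto' (hmain m hm).1 (hmain 1 one_pos).1
      fun y => cGammaPartial_rootGamma_le hirr hdeg m y
  set c₁ : ℝ := rootDensityConst g 1 with hc₁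
  have hc₁0 : 0 ≤ c₁ := hc0 1 one_pos
  set C₀' : ℝ := max C₀ 0 with hC₀'
  have hC₀'0 : 0 ≤ C₀' := le_max_right _ _
  have hlog2 : 0 < Real.log 2 := Real.log_pos (by norm_num)
  refine ⟨C₀' * c₁ * L₀ + c₁ * Real.log 2 + C₀' * c₁ * n, fun m hm =>
    ⟨(hmain m hm).1, hc0 m hm, hc1 m hm, fun x hx => ?_⟩⟩
  set c : ℝ := rootDensityConst g m with hc
  have hcm0 : 0 ≤ c := hc0 m hm
  have hcm1 : c ≤ c₁ := hc1 m hm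
  have hx1 : (1 : ℝ) ≤ x := by exact_mod_cast hx
  have hz : (2 : ℝ) ≤ (x : ℝ) + 1 := by linarith
  have h1 := (hmain m hm).2 ((x : ℝ) + 1) hz
  rw [moebiusSqGSum_rootGamma g m x] at h1
  have hlogm : 0 ≤ Real.log m := Real.log_natCast_nonneg m
  have hL1 : 1 ≤ L₀ + n * Real.log m := by
    have : 0 ≤ n * Real.log m := mul_nonneg hn0 hlogm
    linarith
  -- replace `C₀ c L` by `C₀' c₁ L`
  have h2 : C₀ * c * (L₀ + n * Real.log m) ≤ C₀' * c₁ * (L₀ + n * Real.log m) := by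
    have ha : C₀ * c * (L₀ + n * Real.log m) ≤ C₀' * c * (L₀ + n * Real.log m) := by
      have : C₀ * c ≤ C₀' * c := mul_le_mul_of_nonneg_right (le_max_left _ _) hcm0
      exact mul_le_mul_of_nonneg_right this (by linarith)
    have hb : C₀' * c * (L₀ + n * Real.log m) ≤ C₀' * c₁ * (L₀ + n * Real.log m) := by
      have : C₀' * c ≤ C₀' * c₁ := mul_le_mul_of_nonneg_left hcm1 hC₀'0
      exact mul_le_mul_of_nonneg_right this (by linarith)
    exact ha.trans hb
  -- `log (x+1) − log x ≤ log 2`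
  have hx0 : (0 : ℝ) < x := by linarith
  have h3 : |c * Real.log ((x : ℝ) + 1) - c * Real.log x| ≤ c₁ * Real.log 2 := by
    rw [← mul_sub, ← Real.log_div (by linarith) hx0.ne', abs_of_nonneg]
    · refine mul_le_mul hcm1 ?_ ?_ hc₁0
      · apply Real.log_le_log (by positivity)
        rw [div_le_iff₀ hx0]
        linarith
      · apply Real.log_nonneg
        rw [le_div_iff₀ hx0]
        linarith
    · apply mul_nonneg hcm0
      apply Real.log_nonneg
      rw [le_div_iff₀ hx0]
      linarith
  have h4 : |polySqfreeLevel g m x - c * Real.log x| ≤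
      |polySqfreeLevel g m x - c * Real.log ((x : ℝ) + 1)| +
        |c * Real.log ((x : ℝ) + 1) - c * Real.log x| := by
    have := abs_sub_le (polySqfreeLevel g m x) (c * Real.log ((x : ℝ) + 1)) (c * Real.log x)
    exact this
  have h5 : C₀' * c₁ * (L₀ + n * Real.log m) + c₁ * Real.log 2 ≤
      (C₀' * c₁ * L₀ + c₁ * Real.log 2 + C₀' * c₁ * n) * (1 + Real.log m) := by
    have hK1 : 0 ≤ C₀' * c₁ * L₀ := by positivity
    have hK3 : 0 ≤ C₀' * c₁ * n := by positivity
    nlinarith [mul_nonneg hK1 hlogm, mul_nonneg (mul_nonneg hc₁0 hlog2.le) hlogm]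
  linarith [h1, h2, h3, h4, h5]

/-- The case `m = 1`: `|∑_{d ≤ x, μ²(d) = 1} ρ_g(d)/d − c_{g,1} log x| ≤ K` for all `x ≥ 1`.
[this work] -/
theorem exists_abs_polySqfreeLevel_one_sub_le {g : ℤ[X]} (hirr : Irreducible g)
    (hdeg : 0 < g.natDegree) :
    ∃ K : ℝ, ∀ x : ℕ, 1 ≤ x →
      |(∑ d ∈ (Icc 1 x).filter Squarefree, (polyRootCountMod ![g] d : ℝ) / d) -
          rootDensityConst g 1 * Real.log x| ≤ K := by
  obtain ⟨K, hK⟩ := exists_abs_polySqfreeLevel_sub_le hirr hdeg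
  refine ⟨K, fun x hx => ?_⟩
  have h := (hK 1 one_pos).2.2.2 x hx
  have hs : (Icc 1 x).filter Squarefree =
      (Icc 1 x).filter (fun d => Squarefree d ∧ d.Coprime 1) := by
    refine Finset.filter_congr fun d _ => ?_
    simp [Nat.coprime_one_right_eq_true]
  rw [hs]
  simpa [polySqfreeLevel] using h

end Summit.Parity.BatemanHorn.Theorems
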